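import Literature.AlgebraicGeometry.Resolution.AlterationsStableModel
import Literature.AlgebraicGeometry.Resolution.AlterationsStrictTransform
import Literature.AlgebraicGeometry.Resolution.AlterationsPreSemiStablePullback
import Mathlib.AlgebraicGeometry.IdealSheaf.Functorial
import HarnessLib

/-!
# De Jong's alteration theorem: (vi) f) and (vi) g) for the strict transform of 4.15 — 4.17 after the stable extension

Topic: `Literature/AlgebraicGeometry/Resolution`. Proofs for the end of de Jong 1996, 4.17:

> "Replacing `Y` by `Y'` and `X` by `X'` as in 4.15 we reduce to a case in which (i)–(iv),
> (vi) a)–f) hold and (vi) g) There exist a stable `n`-pointed curve `(𝒞, τ₁, …, τₙ)` over `Y`,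
> a nonempty open subscheme `U ⊂ Y` and an isomorphism `β : 𝒞_U → X_U` mapping the section
> `τᵢ|_U` to the section `σᵢ|_U`. Again we remark that (vi) g) is preserved by operations as in
> 4.15, by putting `𝒞' = 𝒞 ×_Y Y'`, etc." (p. 72); "(vi) f) is also preserved by alterations
> as in 4.15" (4.16, p. 71); "4.15. […] Here `X'` is the reduction of the scheme `Y' ×_Y X`
> […] As before it is clear that it suffices to prove the theorem for the pair `(X', Z')`."
> (p. 71)

The strict transform `X'` of 4.15 enters, as in the named fact `DeJong1996StrictTransform`
(`AlterationsStrictTransform.lean`), through its characterisation: a surjective closed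
immersion `ι : X' → X ×_Y Y'` (from a reduced scheme), with `f' = ι ≫ pr_{Y'}` and
`φ = ι ≫ pr_X`. Everything here is PROVED:

* reduced sources: the kernel of a morphism with reduced source is the vanishing ideal sheaf
  of the closure of its range (`ker_eq_vanishingIdeal_closure_range`), so such a morphism lifts
  through any closed immersion containing its range (`IsClosedImmersion.liftOfRange`);
* **(vi) f) for the strict transform** (4.16): over a reduced `Y'` the pulled-back sections
  `(σᵢ ∘ ψ, 𝟙)` (`DeJong1996.PreSemiStablePair.pullbackSection`) factor through `X'`
  (`DeJong1996.StrictTransform.sect`), are sections of `f'`, are pairwise distinct when the `σᵢ`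
  are (`ψ` dominant, `Y` reduced, `f` separated: Mathlib's `ext_of_isDominant_of_isSeparated`),
  and `φ⁻¹(⋃ᵢ σᵢ(Y)) = ⋃ᵢ σ'ᵢ(Y')` (`DeJong1996.StrictTransform.isUnionOfSections`);
* **(vi) g) for the strict transform** (4.17): a pointed semi-stable model
  (`DeJong1996.HasPointedSemiStableModel`) of the pulled-back family `X ×_Y Y' → Y'` with its
  pulled-back sections is one of `(f' : X' → Y', σ'ᵢ)` — over the open `U` of the model,
  `X ×_Y U ≅ 𝒞_U` is reduced (an open of the integral `𝒞`), so the surjective closed immersion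
  `ι` is an isomorphism over `U` (`DeJong1996.StrictTransform.hasPointedSemiStableModel`), whence
  (vi) f) + g) (`DeJong1996.StrictTransform.isUnionOfSectionsWithModel`);
* **4.17 after the stable extension, from 4.15**
  (`DeJong1996.FibredPair.conclusionGenericallyEtale_of_strictTransform_of_model`): given the
  named fact `DeJong1996StrictTransform` (4.15), a fibred pair `(X, Z)` with (vi) e) and (vi) f),
  and a generically étale alteration `ψ : Y' → Y` from a projective variety carrying a pointed
  semi-stable model of the pulled-back family, Thm. 4.1 with its generically-étale clause for
  `(X, Z)` follows from the same for all fibred pairs over `Y' → Spec k` with (vi) e),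
  (vi) f) + g) and `dim = dim X` — the strict transform is such a pair (4.15, the two items
  above, 2.20 `IsAlteration.topologicalKrullDim_eq`) and 4.4 descends along `φ`
  (`DeJong1996.ConclusionGenericallyEtale.of_strictTransform`). This is the statement of the
  named fact `DeJong1996StrictTransformWithModel` (`AlterationsStableModelParts.lean`) with
  `DeJong1996StrictTransform` as hypothesis.

## Sources

* A. J. de Jong, *Smoothness, semi-stability and alterations*, Publ. Math. IHÉS 83 (1996) 51–93:
  2.18, 2.20 (pp. 60–61), Thm. 4.1, 4.4 (p. 66), 4.15–4.17 (pp. 71–72).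
-/

noncomputable section

open CategoryTheory CategoryTheory.Limits AlgebraicGeometry TopologicalSpace Topology

namespace Literature.AlgebraicGeometry.Resolution

universe u

open Scheme.IdealSheafData

/-! ## Reduced sources: kernels and lifts through closed immersions -/

/-- The kernel (ideal sheaf) of a morphism with REDUCED source is the vanishing ideal sheaf of
the closure of its range (push forward `⊥ = nilradical = vanishingIdeal ⊤`, Mathlib
`map_vanishingIdeal`). [folklore] -/
theorem ker_eq_vanishingIdeal_closure_range {X Y : Scheme.{u}} [IsReduced X] (f : X ⟶ Y) :
    f.ker = vanishingIdeal (Closeds.closure (Set.range f)) := by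
  have h : (⊥ : X.IdealSheafData) = vanishingIdeal ⊤ := by
    rw [vanishingIdeal_top, Scheme.nilradical_eq_bot]
  rw [← map_bot, h, map_vanishingIdeal]
  congr 1
  ext1
  simp [Set.image_univ]

/-- For a closed immersion `c : Z → Y` and a morphism `g : X → Y` from a reduced scheme whose
range lies in that of `c`, the kernel of `c` is contained in the kernel of `g`. [folklore] -/
theorem IsClosedImmersion.ker_le_ker_of_range_subset {X Y Z : Scheme.{u}} [IsReduced X]
    (c : Z ⟶ Y) [IsClosedImmersion c] (g : X ⟶ Y) (h : Set.range g ⊆ Set.range c) :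
    c.ker ≤ g.ker := by
  rw [ker_eq_vanishingIdeal_closure_range g, ← le_support_iff_le_vanishingIdeal]
  intro y hy
  have hy' : y ∈ closure (Set.range g) := hy
  rw [← SetLike.mem_coe, Scheme.Hom.support_ker]
  exact closure_mono h hy'

/-- **Lifting through a closed immersion from a reduced source**: a morphism `g : X → Y` from a
reduced scheme whose range lies in the range of the closed immersion `c : Z → Y` factors through
`c`. [folklore] -/
def IsClosedImmersion.liftOfRange {X Y Z : Scheme.{u}} [IsReduced X] (c : Z ⟶ Y)
    [IsClosedImmersion c] (g : X ⟶ Y) (h : Set.range g ⊆ Set.range c) : X ⟶ Z :=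
  IsClosedImmersion.lift c g (IsClosedImmersion.ker_le_ker_of_range_subset c g h)

/-- The lift composed with the closed immersion is the given morphism. [folklore] -/
@[reassoc (attr := simp)]
theorem IsClosedImmersion.liftOfRange_fac {X Y Z : Scheme.{u}} [IsReduced X] (c : Z ⟶ Y)
    [IsClosedImmersion c] (g : X ⟶ Y) (h : Set.range g ⊆ Set.range c) :
    IsClosedImmersion.liftOfRange c g h ≫ c = g :=
  IsClosedImmersion.lift_fac _ _ _

/-- **A surjective closed immersion is an isomorphism over every reduced open of the target.**
[folklore] -/
theorem isIso_morphismRestrict_of_isClosedImmersion_of_surjective {X Y : Scheme.{u}} (ι : X ⟶ Y)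
    [IsClosedImmersion ι] [Surjective ι] (W : Y.Opens) [IsReduced (W : Scheme.{u})] :
    IsIso (ι ∣_ W) :=
  haveI : Surjective (ι ∣_ W) := IsZariskiLocalAtTarget.restrict (P := @Surjective) inferInstance W
  isIso_of_isClosedImmersion_of_surjective _

namespace DeJong1996

/-! ## The strict transform of 4.15 through its characterisation -/

/-! The situation "`ι : X' → X ×_Y Y'` is (isomorphic to) the reduction of `X ×_Y Y'`" of 4.15
is used through: `ι` is a closed immersion and surjective (and, where needed, `X'` reduced), as
in the named fact `DeJong1996StrictTransform`. We write `f' = ι ≫ pr_{Y'}` and `φ = ι ≫ pr_X`.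
The namespace `StrictTransform` collects what (vi) f) and (vi) g) become on `X'`. -/
namespace StrictTransform

variable {X Y Y' X' : Scheme.{u}} {f : X ⟶ Y} {ψ : Y' ⟶ Y} (ι : X' ⟶ pullback f ψ)
  [IsClosedImmersion ι] {n : ℕ} {σ : Fin n → (Y ⟶ X)}

omit [IsClosedImmersion ι] in
/-- Preimages under `φ = ι ≫ pr_X` are preimages under `pr_X` pulled back along `ι`. [folklore] -/
theorem preimage_comp_fst (Z : Set X) :
    (ι ≫ pullback.fst f ψ) ⁻¹' Z = ι ⁻¹' (pullback.fst f ψ ⁻¹' Z) := by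
  rw [Scheme.Hom.comp_base, TopCat.coe_comp, Set.preimage_comp]

/-- The sections `σ'ᵢ : Y' → X'` of the strict transform induced by sections `σᵢ` of `f`: the
pulled-back sections `(σᵢ ∘ ψ, 𝟙) : Y' → X ×_Y Y'` factor through the surjective closed
immersion `ι` because `Y'` is reduced ("(vi) f) is also preserved by alterations as in 4.15",
4.16). [cite: DeJong1996, 4.16, p. 71] -/
def sect [Surjective ι] [IsReduced Y'] (hσ : ∀ i, σ i ≫ f = 𝟙 Y) (i : Fin n) : Y' ⟶ X' :=
  IsClosedImmersion.liftOfRange ι (PreSemiStablePair.pullbackSection hσ ψ i)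
    (by rw [Set.range_eq_univ.mpr ι.surjective]; exact Set.subset_univ _)

variable [Surjective ι] [IsReduced Y']

/-- `σ'ᵢ ≫ ι` is the pulled-back section `(σᵢ ∘ ψ, 𝟙)`. [folklore] -/
@[reassoc (attr := simp)]
theorem sect_ι (hσ : ∀ i, σ i ≫ f = 𝟙 Y) (i : Fin n) :
    sect ι hσ i ≫ ι = PreSemiStablePair.pullbackSection hσ ψ i :=
  IsClosedImmersion.liftOfRange_fac _ _ _

/-- `σ'ᵢ` is a section of `f' = ι ≫ pr_{Y'}`. [cite: DeJong1996, 4.16, p. 71] -/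
@[reassoc (attr := simp)]
theorem sect_snd (hσ : ∀ i, σ i ≫ f = 𝟙 Y) (i : Fin n) :
    sect ι hσ i ≫ ι ≫ pullback.snd f ψ = 𝟙 Y' := by
  rw [sect_ι_assoc, PreSemiStablePair.pullbackSection_snd]

/-- `σ'ᵢ ≫ φ = ψ ≫ σᵢ`. [folklore] -/
@[reassoc (attr := simp)]
theorem sect_fst (hσ : ∀ i, σ i ≫ f = 𝟙 Y) (i : Fin n) :
    sect ι hσ i ≫ ι ≫ pullback.fst f ψ = ψ ≫ σ i := by
  rw [sect_ι_assoc, PreSemiStablePair.pullbackSection_fst]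

/-- The range of `σ'ᵢ` is the preimage under `ι` of the range of the pulled-back section (`ι` is
injective). [folklore] -/
theorem range_sect (hσ : ∀ i, σ i ≫ f = 𝟙 Y) (i : Fin n) :
    Set.range (sect ι hσ i) = ι ⁻¹' Set.range (PreSemiStablePair.pullbackSection hσ ψ i) := by
  rw [← sect_ι ι hσ i, Scheme.Hom.comp_base, TopCat.coe_comp, Set.range_comp,
    Set.preimage_image_eq _ ι.isClosedEmbedding.injective]

/-- The sections `σ'ᵢ` are pairwise distinct when the `σᵢ` are, for `ψ` dominant, `Y` reduced and
`f` separated: `σ'ᵢ = σ'ⱼ` gives `ψ ≫ σᵢ = ψ ≫ σⱼ`, and two sections of the separated `f` over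
the reduced `Y` which agree after the dominant `ψ` agree (their equaliser is a closed subscheme
of `Y` through which `ψ` factors; Mathlib's `ext_of_isDominant_of_isSeparated`).
[cite: DeJong1996, 4.16, p. 71] -/
theorem sect_injective [IsReduced Y] [IsSeparated f] [IsDominant ψ] (hσ : ∀ i, σ i ≫ f = 𝟙 Y)
    (hinj : Function.Injective σ) : Function.Injective (sect ι hσ) := by
  intro i j hij
  apply hinj
  have h := congrArg (fun t => t ≫ ι ≫ pullback.fst f ψ) hij
  simp only [sect_fst] at h
  exact ext_of_isDominant_of_isSeparated f (by rw [hσ i, hσ j]) ψ h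

/-- **`Z' = φ⁻¹(Z)` is the union of the images of the `σ'ᵢ`** when `Z = ⋃ᵢ σᵢ(Y)`.
[cite: DeJong1996, 4.16, p. 71] -/
theorem preimage_iUnion_range (hσ : ∀ i, σ i ≫ f = 𝟙 Y) :
    (ι ≫ pullback.fst f ψ) ⁻¹' (⋃ i, Set.range (σ i)) = ⋃ i, Set.range (sect ι hσ i) := by
  ext x
  simp only [preimage_comp_fst, Set.preimage_iUnion, Set.mem_preimage, Set.mem_iUnion,
    range_sect, PreSemiStablePair.range_pullbackSection]

/-- **(vi) f) for the strict transform** (4.16: "(vi) f) is also preserved by alterations as in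
4.15"): if `Z = ⋃ᵢ σᵢ(Y)` for pairwise distinct sections of the separated `f` over the reduced
`Y` (`IsUnionOfSections f Z`), then `φ⁻¹(Z) = ⋃ᵢ σ'ᵢ(Y')` for the pairwise distinct sections
`σ'ᵢ` of `f'`, for `ψ` dominant with `Y'` reduced. [cite: DeJong1996, 4.16, p. 71] -/
theorem isUnionOfSections [IsReduced Y] [IsSeparated f] [IsDominant ψ] {Z : Set X}
    (h : IsUnionOfSections f Z) :
    IsUnionOfSections (ι ≫ pullback.snd f ψ) ((ι ≫ pullback.fst f ψ) ⁻¹' Z) := by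
  obtain ⟨n, σ, hinj, hσ, rfl⟩ := h
  exact ⟨n, sect ι hσ, sect_injective ι hσ hinj, sect_snd ι hσ, preimage_iUnion_range ι hσ⟩

/-! ## (vi) g) for the strict transform (4.17) -/

/-- **A pointed semi-stable model of the pulled-back family is one of the strict transform**
(4.17: "Replacing `Y` by `Y'` and `X` by `X'` as in 4.15 we reduce to a case in which […]
(vi) g)"): if `(X ×_Y Y' → Y', σ'ᵢ)` has a pointed semi-stable model `(𝒞, τ)` over the
non-empty open `U ⊆ Y'`, `β : 𝒞_U ⥲ X ×_Y U`, then so has `(f' : X' → Y', σ'ᵢ)`: `X ×_Y U ≅ 𝒞_U`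
is reduced (an open subscheme of the integral `𝒞`), so the surjective closed immersion `ι` is
an isomorphism over `U`, and `β` followed by the inverse of that isomorphism is the required
one, compatible with the sections since `ι` is a monomorphism. [cite: DeJong1996, 4.17, p. 72] -/
theorem hasPointedSemiStableModel {k : Type u} [Field k] (g' : Y' ⟶ Spec (.of k))
    (hσ : ∀ i, σ i ≫ f = 𝟙 Y)
    (h : HasPointedSemiStableModel (pullback.snd f ψ) g' (PreSemiStablePair.pullbackSection hσ ψ)) :
    HasPointedSemiStableModel (ι ≫ pullback.snd f ψ) g' (sect ι hσ) := by
  obtain ⟨C, p, τ, U, β, hC, hproj, hpt, hU, hβ, hcomm, hsec⟩ := h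
  haveI := hC
  haveI := hβ
  -- `X ×_Y U ≅ 𝒞_U` is reduced, so `ι` is an isomorphism over `pr₂⁻¹(U)`
  haveI : IsReduced ((pullback.snd f ψ ⁻¹ᵁ U : (pullback f ψ).Opens) : Scheme.{u}) := by
    haveI : IsReduced ((p ⁻¹ᵁ U : C.Opens) : Scheme.{u}) := isReduced_of_isOpenImmersion (p ⁻¹ᵁ U).ι
    exact isReduced_of_isOpenImmersion (inv β)
  -- `e : X'_U → (X ×_Y Y')_U`, the restriction of `ι` over `pr₂⁻¹(U)`; `f'⁻¹(U) = ι⁻¹(pr₂⁻¹(U))`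
  let e : (((ι ≫ pullback.snd f ψ) ⁻¹ᵁ U : X'.Opens) : Scheme.{u}) ⟶
      (pullback.snd f ψ ⁻¹ᵁ U : (pullback f ψ).Opens) :=
    ι ∣_ (pullback.snd f ψ ⁻¹ᵁ U)
  have he : e ≫ (pullback.snd f ψ ⁻¹ᵁ U).ι = ((ι ≫ pullback.snd f ψ) ⁻¹ᵁ U).ι ≫ ι :=
    morphismRestrict_ι _ _
  haveI : IsIso e :=
    isIso_morphismRestrict_of_isClosedImmersion_of_surjective ι (pullback.snd f ψ ⁻¹ᵁ U)
  have hinv : inv e ≫ ((ι ≫ pullback.snd f ψ) ⁻¹ᵁ U).ι ≫ ι = (pullback.snd f ψ ⁻¹ᵁ U).ι := by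
    rw [← he, IsIso.inv_hom_id_assoc]
  refine ⟨C, p, τ, U, β ≫ inv e, hC, hproj, hpt, hU, inferInstance, ?_, fun i => ?_⟩
  · rw [Category.assoc, reassoc_of% hinv]
    exact hcomm
  · obtain ⟨t, ht, htβ⟩ := hsec i
    refine ⟨t, ht, ?_⟩
    rw [← cancel_mono ι]
    simp only [Category.assoc]
    rw [sect_ι, hinv]
    exact htβ

/-- **(vi) f) + g) for the strict transform**: with `Z = ⋃ᵢ σᵢ(Y)` for pairwise distinct sections
of the separated `f` over the reduced `Y`, `ψ` dominant with `Y'` reduced, and a pointed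
semi-stable model of the pulled-back family with its pulled-back sections, the strict transform
has (vi) f) + g) for `Z' = φ⁻¹(Z)` (`IsUnionOfSectionsWithModel`).
[cite: DeJong1996, 4.16–4.17, pp. 71–72] -/
theorem isUnionOfSectionsWithModel {k : Type u} [Field k] [IsReduced Y] [IsSeparated f]
    [IsDominant ψ] (g' : Y' ⟶ Spec (.of k)) (hσ : ∀ i, σ i ≫ f = 𝟙 Y)
    (hinj : Function.Injective σ) {Z : Set X} (hZ : Z = ⋃ i, Set.range (σ i))
    (h : HasPointedSemiStableModel (pullback.snd f ψ) g' (PreSemiStablePair.pullbackSection hσ ψ)) :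
    IsUnionOfSectionsWithModel (ι ≫ pullback.snd f ψ) g' ((ι ≫ pullback.fst f ψ) ⁻¹' Z) := by
  subst hZ
  exact IsUnionOfSectionsWithModel.mk' (sect_injective ι hσ hinj) (sect_snd ι hσ)
    (preimage_iUnion_range ι hσ) (hasPointedSemiStableModel ι g' hσ h)

end StrictTransform

/-! ## 4.17 after the stable extension, from 4.15 -/

/-- **de Jong 1996, end of 4.17 from 4.15: "Replacing `Y` by `Y'` and `X` by `X'` as in 4.15 we
reduce to a case in which (i)–(iv), (vi) a)–f) hold and (vi) g)".** Assume the named fact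
`DeJong1996StrictTransform` (4.15). Let `(X, Z)` with `f : X → Y → Spec k`, `k` algebraically
closed, be a fibred pair with (vi) e) and (vi) f) `Z = ⋃ᵢ σᵢ(Y)` (pairwise distinct sections),
and let `ψ : Y' → Y` be a generically étale alteration from a projective variety `Y'` such that
the pulled-back family `(X ×_Y Y' → Y', (σᵢ ∘ ψ, 𝟙))` has a pointed semi-stable model over a
non-empty open of `Y'` ((vi) g), as the stable extension of 4.17/2.24 provides). If Thm. 4.1
with its generically-étale clause holds for every fibred pair over `Y' → Spec k` with (vi) e),
(vi) f) + g) and `dim = dim X`, then it holds for `(X → Spec k, Z)`: the strict transform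
`(X', φ⁻¹Z)` of 4.15 is such a pair — a fibred pair with (vi) e) by 4.15, with (vi) f) + g) by
`StrictTransform.isUnionOfSectionsWithModel`, of dimension `dim X` since `φ` is an alteration
(2.20) — and "it suffices to prove the theorem for the pair `(X', Z')`" (4.4 along the
generically étale alteration `φ`, `ConclusionGenericallyEtale.of_strictTransform`). This is the
named fact `DeJong1996StrictTransformWithModel` of `AlterationsStableModelParts.lean` with 4.15
as hypothesis. [cite: DeJong1996, 4.15–4.17, pp. 71–72] -/
theorem FibredPair.conclusionGenericallyEtale_of_strictTransform_of_model
    (h415 : DeJong1996StrictTransform.{u}) {k : Type u} [Field k] [IsAlgClosed k]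
    {X Y : Scheme.{u}} [IsIntegral Y] {f : X ⟶ Y} [LocallyOfFinitePresentation f]
    {g : Y ⟶ Spec (.of k)} {Z : Set X} {n : ℕ} {σ : Fin n → (Y ⟶ X)}
    (hσ : ∀ i, σ i ≫ f = 𝟙 Y) (hP : FibredPair f g Z) (h3 : HasThreeSmoothPoints f Z)
    (hinj : Function.Injective σ) (hZ : Z = ⋃ i, Set.range (σ i)) {Y' : Scheme.{u}}
    [IsIntegral Y'] (ψ : Y' ⟶ Y)
    (hproj : Literature.AlgebraicGeometry.Motives.IsProjectiveOver (Over.mk (ψ ≫ g)))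
    (hψ : IsAlteration ψ) (hψe : IsGenericallyEtale ψ)
    (hmod : HasPointedSemiStableModel (pullback.snd f ψ) (ψ ≫ g)
      (PreSemiStablePair.pullbackSection hσ ψ))
    (H : ∀ (X' : Scheme.{u}) (f' : X' ⟶ Y') [LocallyOfFinitePresentation f'] (Z' : Set X'),
      FibredPair f' (ψ ≫ g) Z' → HasThreeSmoothPoints f' Z' →
        IsUnionOfSectionsWithModel f' (ψ ≫ g) Z' → topologicalKrullDim X' = topologicalKrullDim X →
          ConclusionGenericallyEtale (f' ≫ ψ ≫ g) Z') :
    ConclusionGenericallyEtale (f ≫ g) Z := by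
  haveI := hP.isIntegral
  haveI : IsSeparated f := by
    haveI := hP.isSeparated
    exact IsSeparated.of_comp (f := f) (g := g)
  haveI : IsDominant ψ := hψ.isDominant
  haveI : LocallyOfFiniteType (f ≫ g) := hP.locallyOfFiniteType
  -- 4.15: the strict transform `X'` with `ι : X' → X ×_Y Y'`
  obtain ⟨X', ι, hι, hιs, hred, hlofp, hP', h3', hφ, hφe⟩ := h415 k X Y Y' f g Z ψ hP h3 hψ hψe hproj
  haveI := hι
  haveI := hιs
  haveI := hlofp
  -- 4.4 along `φ = ι ≫ pr_X`
  refine ConclusionGenericallyEtale.of_strictTransform f g ψ Z ι hφ hφe ?_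
  refine H X' (ι ≫ pullback.snd f ψ) ((ι ≫ pullback.fst f ψ) ⁻¹' Z) hP' h3' ?_ ?_
  · -- (vi) f) + g) for the strict transform
    exact StrictTransform.isUnionOfSectionsWithModel ι (ψ ≫ g) hσ hinj hZ hmod
  · -- `dim X' = dim X` along the alteration `φ` (2.20)
    exact hφ.topologicalKrullDim_eq (f ≫ g)

end DeJong1996

end Literature.AlgebraicGeometry.Resolution

end
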